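import Summits.ValiantsHypothesis.ValiantsHypothesis.Theorems.AnyonJetsJetConstantElimIntegralMultipleNumberField
import Summits.ValiantsHypothesis.ValiantsHypothesis.Theorems.AnyonJetsJetConstantElimIntegralMultipleDenominators
import Summits.ValiantsHypothesis.ValiantsHypothesis.Theorems.AnyonJetsJetConstantElimDefs
import Mathlib.NumberTheory.Padics.PadicVal.Basic
import HarnessLib

/-!
# AnyonJets — crux `JetConstantElimTwoAdic` (stmt-ValiantsHypothesis-23655, the multiplier bypass
# of `JetConstantElim` stmt-16737), stub `∃ b₁, IntegralMultipleTwoAdicWith b₁`: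
# the 2-adically integral slices and the reduction to the height normal form

After the re-glue of route `AnyonJets` (rev 5: `closes (CF^ult) (JetConstantElimTwoAdic) (U)`),
the one open stub of the attacked crux is `∃ b₁, IntegralMultipleTwoAdicWith b₁`
(`…JetConstantElimDefs`): the registered `stub_integralMultiple` of line `birth` PLUS the conjunct
`v₂(M) ≤ (size Q + n + 2)^{b₁}` on the multiplier. The landed free slices of `stub_integralMultiple`
(`…IntegralMultipleDenominators` = denominators, `…IntegralMultipleNumberField` = bounded degree
and height) produce the EXPLICIT multiplier `M = N^(2^(3 size Q))`, `N` the common denominator of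
the (coordinates of the) constants; so `v₂(M) = 2^(3 size Q) · v₂(N)`, polynomially bounded
exactly when `N` is ODD, i.e. when the constants are 2-ADICALLY INTEGRAL elements of
`(1/N) · Σ_l ℤ β_l` — which is the route header's own `HeightNormalForm` ("a near-optimal circuit
can be taken over `ℚ̄` with 2-adically integral constants of polynomial height"). This file:

* `constantFreeComplexity_oddMultiple_le_of_numberField_circuit` — the bounded-degree
  bounded-height slice with the multiplier EXPLICIT:
  `τ(N^(2^(3s)) · f) + 2 ≤ 128 (d+1)³ (s + h + 2)²` (same construction as
  `exists_integralMultiple_of_numberField_circuit`).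
* `integralMultipleTwoAdic_ratOddSlice`, `integralMultipleTwoAdic_numberFieldOddSlice` — the
  conclusion of `IntegralMultipleTwoAdicWith` (with `v₂(M) = 0`) for circuits over `ℚ` with an odd
  common denominator, resp. over a number field presented on a basis `β ∋ 1` with integer
  multiplication table and an odd common denominator — for EVERY `f ∈ ℤ[x]`.
* `integralMultipleTwoAdicWith_of_heightNormalFormOdd` — **`HNF₂_a → IntegralMultipleTwoAdicWith
  (5a + 11)`**: the stub of 23655 reduces, in kernel form, to the 2-adically integral height
  normal form (def-free hypothesis); and `integralMultiple_of_heightNormalForm` — the same for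
  the registered `stub_integralMultiple` of 16737 without the parity clause (`HNF_a → IM`).

Honest framing: reductions and free slices; `HNF₂` / `HNF` are conjecture-grade (field of
definition of near-optimal circuits: Bürgisser 2000 Ch. 4, Koiran–Perifel 2011 Rem. 4) and
nothing here proves them; the cruxes stay open; VP ≠ VNP is NOT proved here.
-/

noncomputable section

-- single-conjunct layout: Sub = Summit, duplicated namespace component intended
set_option linter.dupNamespace false

namespace Summit.ValiantsHypothesis.ValiantsHypothesis.Theorems.AnyonJets.JetConstantElim

open MvPolynomial Literature.Computability.AlgebraicComplexity
open Literature.Computability.AlgebraicComplexity.ArithCircuit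
open Summit.ValiantsHypothesis.ValiantsHypothesis.Theorems.AnyonJets.ConstantFreeJetGrowth (jet)
open scoped BigOperators

/-! ### The bounded-degree slice with explicit multiplier -/

/-- **Bounded degree and height, explicit multiplier**: under the hypotheses of
`exists_integralMultiple_of_numberField_circuit`, `τ(N^(2^(3 size Q)) · f) + 2 ≤
128 (d+1)³ (size Q + h + 2)²`. (Same proof: padded skeleton, restriction of scalars on the
coordinates of `β`, substitution of the bounded-height integers.)
[folklore; Bürgisser–Clausen–Shokrollahi 1997 §4.1, Bürgisser 2000 §4.1, Strassen 1973] -/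
theorem constantFreeComplexity_oddMultiple_le_of_numberField_circuit {σ K : Type*} [Field K]
    [CharZero K] (f : MvPolynomial σ ℤ) {d : ℕ} (β : Fin (d + 1) → K) (hβ0 : β 0 = 1)
    (hind : LinearIndependent ℚ β) (γ : Fin (d + 1) → Fin (d + 1) → Fin (d + 1) → ℤ)
    (hβ : ∀ a b, β a * β b = ∑ l, (γ a b l : K) * β l)
    (Q : ArithCircuit K σ) (h2 : Q.IsFanInTwo)
    (hc : Q.Computes (MvPolynomial.map (Int.castRingHom K) f)) (N h : ℕ)
    (hNh : N ≤ 2 ^ h) (P : Fin (4 * Q.size + 1) → Fin (d + 1) → ℤ)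
    (hP : ∀ v : Fin (4 * Q.size + 1), (N : K) * slotConst Q v = ∑ l, (P v l : K) * β l)
    (hPh : ∀ v l, (P v l).natAbs ≤ 2 ^ h) (hγh : ∀ a b l, (γ a b l).natAbs ≤ 2 ^ h) :
    constantFreeComplexity (((N : ℤ) ^ 2 ^ (3 * Q.size)) • f) + 2 ≤
      128 * (d + 1) ^ 3 * (Q.size + h + 2) ^ 2 := by
  classical
  -- (1) skeleton and padding
  obtain ⟨Γ', hΓ'2, hΓ's, hΓ'size, hκ⟩ := exists_padded_circuit
    (Sum.elim (fun _ => 0) (fun _ => 1) : σ ⊕ Fin (4 * Q.size + 1) → ℕ)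
    (by rintro (i | i) <;> simp) (skeleton Q) (isFanInTwo_skeleton Q) (hasSignConstants_skeleton Q)
  rw [size_skeleton] at hΓ'size hκ
  have hev := aeval_padded_skeleton f Q h2 hc N (fun v => ∑ l, (P v l : K) * β l) hP hκ
  -- (2) reshape the variables: scalar `Option σ` (`none` = z), K-valued `Fin (4s+1)`
  set e : Option (σ ⊕ Fin (4 * Q.size + 1)) → Option σ ⊕ Fin (4 * Q.size + 1) :=
    fun o => Option.elim o (Sum.inl none) (Sum.elim (fun x => Sum.inl (some x)) Sum.inr) with he
  have hΓ''2 : (Γ'.rename e).IsFanInTwo := hΓ'2.rename e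
  have hΓ''s : (Γ'.rename e).HasSignConstants := hΓ's.rename e
  have hΓ''size : (Γ'.rename e).size = Γ'.size := size_rename e Γ'
  have hΓ''eval : (Γ'.rename e).eval = rename e Γ'.eval := eval_rename_apply e Γ'
  -- (3) the coordinate data
  set ρK : Option σ ⊕ Fin (4 * Q.size + 1) → MvPolynomial σ K :=
    Sum.elim (fun a => Option.elim a (C (N : K)) X) (fun v => C (∑ l, (P v l : K) * β l)) with hρK
  set ρZ : Option σ ⊕ ((Fin (4 * Q.size + 1) × Fin (d + 1)) ⊕ (Fin (d + 1) × Fin (d + 1) × Fin (d + 1))) →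
      MvPolynomial σ ℤ :=
    Sum.elim (fun a => Option.elim a (C (N : ℤ)) X)
      (Sum.elim (fun vl => C (P vl.1 vl.2)) (fun abl => C (γ abl.1 abl.2.1 abl.2.2))) with hρZ
  have hsc : ∀ a, ρK (Sum.inl a) = MvPolynomial.map (Int.castRingHom K) (ρZ (Sum.inl a)) := by
    rintro (_ | x) <;> simp [hρK, hρZ]
  have hK : ∀ v, ρK (Sum.inr v) = ∑ l : Fin (d + 1), C (β l) *
      MvPolynomial.map (Int.castRingHom K) (ρZ (Sum.inr (Sum.inl (v, l)))) := by
    intro v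
    simp only [hρK, hρZ, Sum.elim_inr, Sum.elim_inl, map_sum, map_mul, map_intCast, eq_intCast]
    exact Finset.sum_congr rfl fun l _ => mul_comm _ _
  have hβ' : ∀ a b : Fin (d + 1), C (β a) * C (β b) = ∑ l : Fin (d + 1),
      MvPolynomial.map (Int.castRingHom K) (ρZ (Sum.inr (Sum.inr (a, b, l)))) * C (β l) := by
    intro a b
    rw [← map_mul, hβ, map_sum]
    exact Finset.sum_congr rfl fun l _ => by simp [hρZ]
  obtain ⟨Γc, q, hΓc2, hΓcs, hΓcsize, hΓceval, hI⟩ :=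
    exists_coordinate_circuit hβ0 hsc hK hβ' (Γ'.rename e) hΓ''2 hΓ''s
  -- (4) the unit coordinate is `N^E • f`
  have hρe : (ρK ∘ e) = fun o : Option (σ ⊕ Fin (4 * Q.size + 1)) =>
      Option.elim o (C (N : K)) (Sum.elim X (fun v => C (∑ l, (P v l : K) * β l))) := by
    funext o
    rcases o with _ | (x | v) <;> simp [hρK, he]
  have hstar : ∑ l : Fin (d + 1), C (β l) * MvPolynomial.map (Int.castRingHom K) (aeval ρZ (q l)) =
      MvPolynomial.map (Int.castRingHom K) (((N : ℤ) ^ 2 ^ (3 * Q.size)) • f) := by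
    rw [← hI, hΓ''eval, aeval_rename, hρe, hev, smul_eq_C_mul, map_mul, map_C]
    simp
  have hA0 : aeval ρZ (q 0) = ((N : ℤ) ^ 2 ^ (3 * Q.size)) • f :=
    eq_of_sum_C_mul_map_eq β hβ0 hind (fun l => aeval ρZ (q l)) _ hstar
  -- (5) substituting the integers: cost
  set g' : Unit ⊕ ((Fin (4 * Q.size + 1) × Fin (d + 1)) ⊕ (Fin (d + 1) × Fin (d + 1) × Fin (d + 1))) →
      MvPolynomial σ ℤ :=
    Sum.elim (fun _ => C (N : ℤ))
      (Sum.elim (fun vl => C (P vl.1 vl.2)) (fun abl => C (γ abl.1 abl.2.1 abl.2.2))) with hg'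
  set e₂ : Option σ ⊕ ((Fin (4 * Q.size + 1) × Fin (d + 1)) ⊕ (Fin (d + 1) × Fin (d + 1) × Fin (d + 1))) →
      σ ⊕ (Unit ⊕ ((Fin (4 * Q.size + 1) × Fin (d + 1)) ⊕ (Fin (d + 1) × Fin (d + 1) × Fin (d + 1)))) :=
    Sum.elim (fun a => Option.elim a (Sum.inr (Sum.inl ())) Sum.inl) (fun r => Sum.inr (Sum.inr r))
    with he₂
  have hρZe : ρZ = (Sum.elim X g') ∘ e₂ := by
    funext x
    rcases x with (_ | x) | (vl | abl) <;> simp [hρZ, hg', he₂]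
  have hconst : ∀ z : ℤ, z.natAbs ≤ 2 ^ h →
      constantFreeComplexity (C z : MvPolynomial σ ℤ) ≤ 3 * (h + 1) + 1 :=
    fun z hz => constantFreeComplexity_C_le_of_natAbs_le hz
  have hcost : constantFreeComplexity (((N : ℤ) ^ 2 ^ (3 * Q.size)) • f) ≤
      Γc.size + ((3 * (h + 1) + 1) + ((4 * Q.size + 1) * (d + 1) * (3 * (h + 1) + 1) +
        (d + 1) ^ 3 * (3 * (h + 1) + 1))) := by
    rw [← hA0, ← hΓceval, hρZe, ← aeval_rename]
    refine (constantFreeComplexity_aeval_sumElim_le_fintype _ _).trans (add_le_add ?_ ?_)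
    · exact (constantFreeComplexity_rename_le _ _).trans
        (constantFreeComplexity_le_size hΓc2 hΓcs rfl)
    · rw [Fintype.sum_sum_type, Fintype.sum_sum_type, Fintype.sum_unique]
      refine add_le_add ?_ (add_le_add ?_ ?_)
      · simpa [hg'] using hconst (N : ℤ) (by simpa using hNh)
      · refine (Finset.sum_le_card_nsmul _ _ (3 * (h + 1) + 1) fun vl _ => ?_).trans (le_of_eq ?_)
        · simpa [hg'] using hconst _ (hPh vl.1 vl.2)
        · simp only [Finset.card_univ, Fintype.card_prod, Fintype.card_fin, smul_eq_mul]
      · refine (Finset.sum_le_card_nsmul _ _ (3 * (h + 1) + 1) fun abl _ => ?_).trans (le_of_eq ?_)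
        · simpa [hg'] using hconst _ (hγh abl.1 abl.2.1 abl.2.2)
        · simp only [Finset.card_univ, Fintype.card_prod, Fintype.card_fin, smul_eq_mul]
          ring
  have henv := numberField_envelope_le Q.size h d
  have hsizes : Γc.size ≤ (3 * (d + 1) ^ 3 + (d + 1)) * (2 * (3 * Q.size + 2) ^ 2) :=
    hΓcsize.trans (Nat.mul_le_mul_left _ (by rw [hΓ''size]; exact hΓ'size))
  omega

/-! ### The 2-adically integral slices: odd common denominator -/

/-- **The rational 2-adically-integral slice of `IntegralMultipleTwoAdicWith`** (every `f`): a
fan-in-two `ℚ`-circuit for `f ∈ ℤ[x]` with an ODD common denominator `N ≤ 2^h` and numerators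
`≤ 2^h` yields `P`, `t = 0`, `M = N^(2^(3 size Q))` with `v₂(M) = 0` and
`size P + t + 2 ≤ (size Q + h + 2)^8`. [folklore] -/
theorem integralMultipleTwoAdic_ratOddSlice {σ : Type*} (f : MvPolynomial σ ℤ)
    (Q : ArithCircuit ℚ σ) (h2 : Q.IsFanInTwo)
    (hc : Q.Computes (MvPolynomial.map (Int.castRingHom ℚ) f)) (N h : ℕ) (hN : Odd N)
    (hNh : N ≤ 2 ^ h) (p : Fin (4 * Q.size + 1) → ℤ)
    (hp : ∀ v : Fin (4 * Q.size + 1), (N : ℚ) * slotConst Q v = p v)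
    (hph : ∀ v : Fin (4 * Q.size + 1), (p v).natAbs ≤ 2 ^ h) :
    ∃ (P : ArithCircuit ℤ σ) (t M : ℕ),
      1 ≤ M ∧ P.IsFanInTwo ∧ P.Computes ((M : ℤ) • f) ∧
      ((∀ g ∈ P.gates, ∀ u ∈ g.args, ∀ c : ℤ, u = .const c → c.natAbs ≤ 2 ^ t) ∧
        (∀ args : List (ℤ × Operand ℤ σ), Gate.sum args ∈ P.gates →
          ∀ a ∈ args, a.1.natAbs ≤ 2 ^ t) ∧
        (∀ c : ℤ, P.output = .const c → c.natAbs ≤ 2 ^ t)) ∧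
      P.size + t + 2 ≤ (Q.size + h + 2) ^ 8 ∧ padicValNat 2 M = 0 := by
  have hN1 : 1 ≤ N := hN.pos
  have hτ := constantFreeComplexity_multiple_le_of_rat_circuit f Q h2 hc N p hp
  obtain ⟨PC, hP2, hPs, hPc, hPsize⟩ :=
    exists_computes_size_eq_constantFreeComplexity (((N : ℤ) ^ 2 ^ (3 * Q.size)) • f)
  have hsgn : ∀ c : ℤ, IsSignConstant c → c.natAbs ≤ 2 ^ 0 := by
    rintro c (hc0 | hc0 | hc0)
    · subst hc0; simp
    · subst hc0; simp
    · obtain rfl : c = -1 := by omega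
      simp
  have hheight : (∀ g ∈ PC.gates, ∀ u ∈ g.args, ∀ c : ℤ, u = .const c → c.natAbs ≤ 2 ^ 0) ∧
      (∀ args : List (ℤ × Operand ℤ σ), Gate.sum args ∈ PC.gates →
        ∀ a ∈ args, a.1.natAbs ≤ 2 ^ 0) ∧
      (∀ c : ℤ, PC.output = .const c → c.natAbs ≤ 2 ^ 0) := by
    obtain ⟨hg, ho⟩ := hPs
    refine ⟨?_, fun args hargs a ha => hsgn _ ((hg _ hargs) a ha).1, fun c hcO => hsgn _ (by
      rw [hcO] at ho; exact ho)⟩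
    intro g hgP u hu c huc
    subst huc
    have hgs := hg g hgP
    cases g with
    | sum args =>
      simp only [Gate.args, List.mem_map] at hu
      obtain ⟨a, ha, hau⟩ := hu
      have hh := (hgs a ha).2
      rw [hau] at hh
      exact hsgn _ hh
    | prod args => exact hsgn _ (hgs _ hu)
  refine ⟨PC, 0, N ^ 2 ^ (3 * Q.size), Nat.one_le_pow _ _ hN1, hP2, by simpa [Nat.cast_pow] using hPc,
    hheight, ?_, (padicValNat.eq_zero_of_not_dvd fun h2 =>
      hN.not_two_dvd_nat (Nat.prime_two.dvd_of_dvd_pow h2))⟩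
  have hsum : ∑ v : Fin (4 * Q.size + 1), constantFreeComplexity (C (p v) : MvPolynomial σ ℤ) ≤
      (4 * Q.size + 1) * (3 * (h + 1) + 1) :=
    calc ∑ v : Fin (4 * Q.size + 1), constantFreeComplexity (C (p v) : MvPolynomial σ ℤ)
        ≤ ∑ _v : Fin (4 * Q.size + 1), (3 * (h + 1) + 1) :=
          Finset.sum_le_sum fun v _ => constantFreeComplexity_C_le_of_natAbs_le (hph v)
      _ = (4 * Q.size + 1) * (3 * (h + 1) + 1) := by simp
  have hNτ : constantFreeComplexity (C (N : ℤ) : MvPolynomial σ ℤ) ≤ 3 * (h + 1) + 1 :=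
    constantFreeComplexity_C_le_of_natAbs_le (by simpa using hNh)
  have := denominators_envelope_le Q.size h
  omega

/-- **The number-field 2-adically-integral slice of `IntegralMultipleTwoAdicWith`** (every
`f`): as `exists_integralMultiple_of_numberField_circuit` with `N` ODD — the multiplier
`M = N^(2^(3 size Q))` then has `v₂(M) = 0`. [folklore] -/
theorem integralMultipleTwoAdic_numberFieldOddSlice {σ K : Type*} [Field K] [CharZero K]
    (f : MvPolynomial σ ℤ) {d : ℕ} (β : Fin (d + 1) → K) (hβ0 : β 0 = 1)
    (hind : LinearIndependent ℚ β) (γ : Fin (d + 1) → Fin (d + 1) → Fin (d + 1) → ℤ)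
    (hβ : ∀ a b, β a * β b = ∑ l, (γ a b l : K) * β l)
    (Q : ArithCircuit K σ) (h2 : Q.IsFanInTwo)
    (hc : Q.Computes (MvPolynomial.map (Int.castRingHom K) f)) (N h : ℕ) (hN : Odd N)
    (hNh : N ≤ 2 ^ h) (P : Fin (4 * Q.size + 1) → Fin (d + 1) → ℤ)
    (hP : ∀ v : Fin (4 * Q.size + 1), (N : K) * slotConst Q v = ∑ l, (P v l : K) * β l)
    (hPh : ∀ v l, (P v l).natAbs ≤ 2 ^ h) (hγh : ∀ a b l, (γ a b l).natAbs ≤ 2 ^ h) :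
    ∃ (Pc : ArithCircuit ℤ σ) (t M : ℕ),
      1 ≤ M ∧ Pc.IsFanInTwo ∧ Pc.Computes ((M : ℤ) • f) ∧
      ((∀ g ∈ Pc.gates, ∀ u ∈ g.args, ∀ c : ℤ, u = .const c → c.natAbs ≤ 2 ^ t) ∧
        (∀ args : List (ℤ × Operand ℤ σ), Gate.sum args ∈ Pc.gates →
          ∀ a ∈ args, a.1.natAbs ≤ 2 ^ t) ∧
        (∀ c : ℤ, Pc.output = .const c → c.natAbs ≤ 2 ^ t)) ∧
      Pc.size + t + 2 ≤ 128 * (d + 1) ^ 3 * (Q.size + h + 2) ^ 2 ∧ padicValNat 2 M = 0 := by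
  have hN1 : 1 ≤ N := hN.pos
  have hτ := constantFreeComplexity_oddMultiple_le_of_numberField_circuit f β hβ0 hind γ hβ Q h2 hc
    N h hNh P hP hPh hγh
  obtain ⟨PC, hP2, hPs, hPc, hPsize⟩ :=
    exists_computes_size_eq_constantFreeComplexity (((N : ℤ) ^ 2 ^ (3 * Q.size)) • f)
  have hsgn : ∀ c : ℤ, IsSignConstant c → c.natAbs ≤ 2 ^ 0 := by
    rintro c (hc0 | hc0 | hc0)
    · subst hc0; simp
    · subst hc0; simp
    · obtain rfl : c = -1 := by omega
      simp
  have hheight : (∀ g ∈ PC.gates, ∀ u ∈ g.args, ∀ c : ℤ, u = .const c → c.natAbs ≤ 2 ^ 0) ∧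
      (∀ args : List (ℤ × Operand ℤ σ), Gate.sum args ∈ PC.gates →
        ∀ a ∈ args, a.1.natAbs ≤ 2 ^ 0) ∧
      (∀ c : ℤ, PC.output = .const c → c.natAbs ≤ 2 ^ 0) := by
    obtain ⟨hg, ho⟩ := hPs
    refine ⟨?_, fun args hargs a ha => hsgn _ ((hg _ hargs) a ha).1, fun c hcO => hsgn _ (by
      rw [hcO] at ho; exact ho)⟩
    intro g hgP u hu c huc
    subst huc
    have hgs := hg g hgP
    cases g with
    | sum args =>
      simp only [Gate.args, List.mem_map] at hu
      obtain ⟨a, ha, hau⟩ := hu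
      have hh := (hgs a ha).2
      rw [hau] at hh
      exact hsgn _ hh
    | prod args => exact hsgn _ (hgs _ hu)
  refine ⟨PC, 0, N ^ 2 ^ (3 * Q.size), Nat.one_le_pow _ _ hN1, hP2,
    by simpa [Nat.cast_pow] using hPc, hheight, by omega,
    (padicValNat.eq_zero_of_not_dvd fun h2 =>
      hN.not_two_dvd_nat (Nat.prime_two.dvd_of_dvd_pow h2))⟩

/-! ### The stubs reduce to the height normal forms -/

/-- Envelope arithmetic: `128 D³ (s' + h + 2)² ≤ X^(5a+11)` when `D, s', h ≤ X^a` and `X ≥ 2`.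
[folklore] -/
theorem heightNormalForm_envelope_le {X a D s' h : ℕ} (hX : 2 ≤ X) (hD : D ≤ X ^ a)
    (hs : s' ≤ X ^ a) (hh : h ≤ X ^ a) :
    128 * D ^ 3 * (s' + h + 2) ^ 2 ≤ X ^ (5 * a + 11) := by
  have hXa : 1 ≤ X ^ a := Nat.one_le_pow _ _ (by omega)
  have h1 : s' + h + 2 ≤ 4 * X ^ a := by omega
  have h2 : (s' + h + 2) ^ 2 ≤ 16 * (X ^ a) ^ 2 := by
    calc (s' + h + 2) ^ 2 ≤ (4 * X ^ a) ^ 2 := Nat.pow_le_pow_left h1 2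
      _ = 16 * (X ^ a) ^ 2 := by ring
  have h3 : D ^ 3 ≤ (X ^ a) ^ 3 := Nat.pow_le_pow_left hD 3
  have h4 : 2 ^ 11 ≤ X ^ 11 := Nat.pow_le_pow_left hX 11
  calc 128 * D ^ 3 * (s' + h + 2) ^ 2 ≤ 128 * (X ^ a) ^ 3 * (16 * (X ^ a) ^ 2) :=
        Nat.mul_le_mul (Nat.mul_le_mul_left _ h3) h2
    _ = 2 ^ 11 * X ^ (5 * a) := by ring
    _ ≤ X ^ 11 * X ^ (5 * a) := Nat.mul_le_mul_right _ h4
    _ = X ^ (5 * a + 11) := by rw [← pow_add]; ring_nf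

/-- **`HNF₂_a → IntegralMultipleTwoAdicWith (5a + 11)`**: the one open stub of the attacked
crux `JetConstantElimTwoAdic` (stmt-23655) follows from the 2-ADICALLY INTEGRAL HEIGHT NORMAL FORM
of near-optimal `ℚ̄`-circuits of the jets — every fan-in-two `ℚ̄`-circuit `Q` for `J_(n,k)`,
`k ≤ log₂ n`, replaceable by a fan-in-two `ℚ̄`-circuit `Q'` for `J_(n,k)` whose constants lie in
`(1/N) · Σ_l ℤ β_l` for an ODD `N`, a `ℚ`-independent `β ∋ 1` with integer multiplication table,
with `size Q'`, the rank `d + 1` and the height `h` of `N, P, γ` all `≤ (size Q + n + 2)^a`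
(the route header's `HeightNormalForm`: "2-adically integral constants of polynomial height",
here with the degree made explicit). By `integralMultipleTwoAdic_numberFieldOddSlice` inside `ℚ̄`.
[folklore] -/
theorem integralMultipleTwoAdicWith_of_heightNormalFormOdd (a : ℕ)
    (hHNF : ∀ n k : ℕ, k ≤ Nat.log 2 n →
      ∀ Q : ArithCircuit (AlgebraicClosure ℚ) (Fin n × Fin n), Q.IsFanInTwo →
        Q.Computes (MvPolynomial.map (Int.castRingHom (AlgebraicClosure ℚ)) (jet n k)) →
        ∃ (d : ℕ) (β : Fin (d + 1) → AlgebraicClosure ℚ)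
          (γ : Fin (d + 1) → Fin (d + 1) → Fin (d + 1) → ℤ)
          (Q' : ArithCircuit (AlgebraicClosure ℚ) (Fin n × Fin n)) (N h : ℕ)
          (P : Fin (4 * Q'.size + 1) → Fin (d + 1) → ℤ),
          β 0 = 1 ∧ LinearIndependent ℚ β ∧
          (∀ a b, β a * β b = ∑ l, (γ a b l : AlgebraicClosure ℚ) * β l) ∧
          Q'.IsFanInTwo ∧
          Q'.Computes (MvPolynomial.map (Int.castRingHom (AlgebraicClosure ℚ)) (jet n k)) ∧
          Odd N ∧ N ≤ 2 ^ h ∧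
          (∀ v : Fin (4 * Q'.size + 1),
            (N : AlgebraicClosure ℚ) * slotConst Q' v = ∑ l, (P v l : AlgebraicClosure ℚ) * β l) ∧
          (∀ v l, (P v l).natAbs ≤ 2 ^ h) ∧ (∀ a b l, (γ a b l).natAbs ≤ 2 ^ h) ∧
          d + 1 ≤ (Q.size + n + 2) ^ a ∧ h ≤ (Q.size + n + 2) ^ a ∧
          Q'.size ≤ (Q.size + n + 2) ^ a) :
    IntegralMultipleTwoAdicWith (5 * a + 11) := by
  intro n k hk Q hQ2 hQc
  obtain ⟨d, β, γ, Q', N, h, P, hβ0, hind, hβ, hQ'2, hQ'c, hN, hNh, hP, hPh, hγh, hd, hh, hs⟩ :=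
    hHNF n k hk Q hQ2 hQc
  obtain ⟨Pc, t, M, hM, hPc2, hPcc, hPch, hPcsize, hv⟩ :=
    integralMultipleTwoAdic_numberFieldOddSlice (jet n k) β hβ0 hind γ hβ Q' hQ'2 hQ'c N h hN hNh
      P hP hPh hγh
  have henv := heightNormalForm_envelope_le (a := a) (show 2 ≤ Q.size + n + 2 by omega) hd hs hh
  exact ⟨Pc, t, M, hM, hPc2, hPcc, hPch, hPcsize.trans henv, by rw [hv]; exact Nat.zero_le _⟩

/-- **`HNF_a → IM`** (`b₁ = 5a + 11`) for the registered stub `stub_integralMultiple` of the aside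
crux 16737 (no parity clause on `N`, no `v₂` conjunct): by
`integralMultiple_numberFieldSlice` inside `ℚ̄`. [folklore] -/
theorem integralMultiple_of_heightNormalForm (a : ℕ)
    (hHNF : ∀ n k : ℕ, k ≤ Nat.log 2 n →
      ∀ Q : ArithCircuit (AlgebraicClosure ℚ) (Fin n × Fin n), Q.IsFanInTwo →
        Q.Computes (MvPolynomial.map (Int.castRingHom (AlgebraicClosure ℚ)) (jet n k)) →
        ∃ (d : ℕ) (β : Fin (d + 1) → AlgebraicClosure ℚ)
          (γ : Fin (d + 1) → Fin (d + 1) → Fin (d + 1) → ℤ)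
          (Q' : ArithCircuit (AlgebraicClosure ℚ) (Fin n × Fin n)) (N h : ℕ)
          (P : Fin (4 * Q'.size + 1) → Fin (d + 1) → ℤ),
          β 0 = 1 ∧ LinearIndependent ℚ β ∧
          (∀ a b, β a * β b = ∑ l, (γ a b l : AlgebraicClosure ℚ) * β l) ∧
          Q'.IsFanInTwo ∧
          Q'.Computes (MvPolynomial.map (Int.castRingHom (AlgebraicClosure ℚ)) (jet n k)) ∧
          1 ≤ N ∧ N ≤ 2 ^ h ∧
          (∀ v : Fin (4 * Q'.size + 1),
            (N : AlgebraicClosure ℚ) * slotConst Q' v = ∑ l, (P v l : AlgebraicClosure ℚ) * β l) ∧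
          (∀ v l, (P v l).natAbs ≤ 2 ^ h) ∧ (∀ a b l, (γ a b l).natAbs ≤ 2 ^ h) ∧
          d + 1 ≤ (Q.size + n + 2) ^ a ∧ h ≤ (Q.size + n + 2) ^ a ∧
          Q'.size ≤ (Q.size + n + 2) ^ a) :
    ∃ b₁ : ℕ, ∀ n k : ℕ, k ≤ Nat.log 2 n →
      ∀ Q : ArithCircuit (AlgebraicClosure ℚ) (Fin n × Fin n), Q.IsFanInTwo →
        Q.Computes (MvPolynomial.map (Int.castRingHom (AlgebraicClosure ℚ)) (jet n k)) →
        ∃ (P : ArithCircuit ℤ (Fin n × Fin n)) (t M : ℕ),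
          1 ≤ M ∧ P.IsFanInTwo ∧ P.Computes ((M : ℤ) • jet n k) ∧
          ((∀ g ∈ P.gates, ∀ u ∈ g.args, ∀ c : ℤ, u = .const c → c.natAbs ≤ 2 ^ t) ∧
            (∀ args : List (ℤ × Operand ℤ (Fin n × Fin n)), Gate.sum args ∈ P.gates →
              ∀ a ∈ args, a.1.natAbs ≤ 2 ^ t) ∧
            (∀ c : ℤ, P.output = .const c → c.natAbs ≤ 2 ^ t)) ∧
          P.size + t + 2 ≤ (Q.size + n + 2) ^ b₁ := by
  refine ⟨5 * a + 11, fun n k hk Q hQ2 hQc => ?_⟩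
  obtain ⟨d, β, γ, Q', N, h, P, hβ0, hind, hβ, hQ'2, hQ'c, hN1, hNh, hP, hPh, hγh, hd, hh, hs⟩ :=
    hHNF n k hk Q hQ2 hQc
  obtain ⟨Pc, t, M, hM, hPc2, hPcc, hPch, hPcsize⟩ :=
    integralMultiple_numberFieldSlice n k β hβ0 hind γ hβ Q' hQ'2 hQ'c N h hN1 hNh P hP hPh hγh
  exact ⟨Pc, t, M, hM, hPc2, hPcc, hPch,
    hPcsize.trans (heightNormalForm_envelope_le (show 2 ≤ Q.size + n + 2 by omega) hd hs hh)⟩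

end Summit.ValiantsHypothesis.ValiantsHypothesis.Theorems.AnyonJets.JetConstantElim

end
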